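import Literature.AlgebraicGeometry.HodgeTheory.GriffithsHolomorphicHodgeSubbundles
import Literature.AlgebraicGeometry.HodgeTheory.DworkSexticPencilHodgeLoci
import Literature.AlgebraicGeometry.HodgeTheory.DworkSexticPencilFamily
import Literature.AlgebraicGeometry.HodgeTheory.HodgeGenericTypeStabilityOfGenericPoint
import Literature.AlgebraicGeometry.HodgeTheory.SupportedClassesHodgeConiveauProofs
import Literature.AlgebraicGeometry.HodgeTheory.ComplexConjugationHolds
import Literature.AlgebraicGeometry.HodgeTheory.RationalLattice
import Literature.AlgebraicGeometry.HodgeTheory.HodgeFiltrationModels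
import Literature.AlgebraicGeometry.HodgeTheory.SpecialisedHypersurfaceFamilyPoints
import Literature.AlgebraicGeometry.Motives.HodgeTensorFactsHolds
import Mathlib.Analysis.Analytic.IsolatedZeros
import Mathlib.Analysis.Convex.Topology
import HarnessLib

/-!
# The Hodge-locus dichotomy on the Dwork pencil from Griffiths' theorem (Voisin I Thm. 10.3) — the
# pencil-specific frames fact replaced by the general named fact `Griffiths1968_holomorphicHodgeSubbundles`

Family `hodge`, layer `Literature/AlgebraicGeometry/HodgeTheory`; proof file (theorems only, no definition,
no named fact) for the cell hodge-nonav, route `HodgeConjecture/DworkReflectionQuotients`, crux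
`GenericInvariantHodgeClasses` (stmt-HodgeConjecture-24129).

The analytic input `DworkSextic.Voisin2002_dworkPencil_hodgeFiltrationTwo_locus_dichotomy` of that crux
(`DworkSexticPencilHodgeLoci`: on the curve `D(ℂ)`, if the locus `{s : ξ|_{𝒳_s} ∈ F²H⁴}` of a tube class
accumulates at `t`, it is a neighbourhood of `t`) was so far derived (`DworkSexticPencilHolomorphicFrames`)
from the PENCIL-SPECIFIC named fact `DworkSextic.Griffiths1968_dworkPencil_holomorphicHodgeFrames`. Here it is
derived from the GENERAL named fact `Griffiths1968_holomorphicHodgeSubbundles`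
(`GriffithsHolomorphicHodgeSubbundles`: Voisin I Thm. 10.3 for every smooth projective family over a smooth
quasi-projective base, in subbundle-frame form — the statement the Baldi–Klingler–Ullmo line already consumes),
so that the route's residual print dependence for `F²𝓗⁴` is the general theorem, shared with that line:

* §1 (general) `ofRatClassBaseChange_baseChange_eq_transportFun` — a rational transport `T` along `γ`,
  complexified, is the transport of complex classes; `isInHodgeFiltration_iff_symm_mem_hodgeStructure_F` —
  `x ∈ Fʳ` (any Hodge model) iff `Θ⁻¹x ∈ Fʳ` of the `ℚ`-Hodge structure `A.hodgeStructure` read in the flat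
  (rational) frame; `mem_span_image_deg_iff` — membership in the span of the frame vectors of degree `≥ r`
  is the vanishing of the coordinates of degree `< r`.
* §2 `DworkSextic.Voisin2002_dworkPencil_hodgeFiltrationTwo_locus_dichotomy_of_griffiths1968` — the
  dichotomy from `Griffiths1968_holomorphicHodgeSubbundles`: the pencil `π : 𝒳 → D` is a smooth projective
  family over the smooth quasi-projective CURVE `D = 𝔸¹ ∖ μ₆` (`isSmoothProjectiveFamily_pencil`,
  `isQuasiProjectiveOver_baseSpz`, `smoothOfRelativeDimension_baseSpz_hom`), so the fact gives, near `t`, a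
  path-connected open `W` in a chart `ψ : D(ℂ) → ℂ¹` and — through `exists_holomorphicFrame_of_subbundleFrames`
  — a graded holomorphic frame `e(s)` of `H⁴(X_t; ℚ) ⊗ ℂ` adapted to the transported Hodge flags; the tube
  class restricted to `X_s` is the transport of `ξ|_{X_t}` (`transportFun_fiberRestrict`), i.e. the FIXED
  vector `y₀ = Θ⁻¹(ξ|_{X_t})` read through the rational transport (§1), so `ξ|_{X_s} ∈ F²` iff the coordinates
  of `y₀` of degree `< 2` in `e(s)` vanish — holomorphic functions of `ψ(s)`; accumulation at `t` makes them
  vanish near `ψ(t)` (identity theorem in one variable, `AnalyticOnNhd.eqOn_zero_of_preconnected_of_frequently_eq_zero`),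
  hence the locus is a neighbourhood of `t`.

Consumer (Summits side): `genericInvariantHodgeClasses_of_griffiths1968_of_residues` (crux GI BY NAME modulo
{Griffiths 1968 general, Carlson–Griffiths residues along the pencil}) and the rung leaf modulo
{Bini–Garbagnati 3.20, Kollár–Miyaoka–Mori, Griffiths 1968 general, pencil residues}. CONDITIONAL results
downstream; nothing here says HC ∕ HC_AV is proved; rung F-H1 is not moved. Seat hodge-nonav 20241-p1 g12.

## References

* [VoisinHodgeI2002] C. Voisin, Hodge Theory and Complex Algebraic Geometry I, CUP (2002), §9.2.1,
  §10.2.1 Thm. 10.3.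
* [VoisinHodgeII2003] C. Voisin, Hodge Theory and Complex Algebraic Geometry II, CUP (2003), §5.3.1 Lemma 5.13.
* [Griffiths1968PeriodsII] P. Griffiths, Periods of integrals on algebraic manifolds II, Amer. J. Math. 90 (1968).
* [Hartshorne1977] R. Hartshorne, Algebraic Geometry, III §10.
-/

noncomputable section

open _root_.Topology _root_.Filter
open scoped TensorProduct

namespace Literature.AlgebraicGeometry.HodgeTheory

section HodgeTheory

open CategoryTheory
open Literature.AlgebraicTopology.SingularHomology Literature.AlgebraicGeometry.Motives

/-! ### §1 Transport of complexified rational classes and the Hodge filtration in the flat frame -/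

section FlatFrame

variable {𝒳 S : SchemeOver ℂ} (f : 𝒳 ⟶ S) (k : ℕ) {U : Set (ComplexPoints S)}
  (hU : IsCohomologicallyLocallyTrivialOn f U)

/-- **A rational transport `T` along `γ`, complexified, IS the transport of complex classes**: if
`(T v) ⊗ 1 = γ_* (v ⊗ 1)` for all rational `v`, then `Θ (T ⊗ ℂ) y = γ_* (Θ y)` for every
`y ∈ ℂ ⊗_ℚ Hᵏ(X_s; ℚ)`, `Θ = ofRatClassBaseChange` (both sides are `ℂ`-linear and agree on pure tensors).
[cite: VoisinHodgeI2002, §9.2.1] -/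
theorem ofRatClassBaseChange_baseChange_eq_transportFun {s t : U} (γ : Path.Homotopic.Quotient s t)
    (T : singularCohomology ℚ ℚ (ComplexPoints (fiberOver f s.1)) k ≃ₗ[ℚ]
      singularCohomology ℚ ℚ (ComplexPoints (fiberOver f t.1)) k)
    (hT : ∀ v, ofRatClass _ k (T v) = transportFun f k hU γ (ofRatClass _ k v))
    (y : ℂ ⊗[ℚ] singularCohomology ℚ ℚ (ComplexPoints (fiberOver f s.1)) k) :
    ofRatClassBaseChange (ComplexPoints (fiberOver f t.1)) k (T.toLinearMap.baseChange ℂ y) =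
      transportFun f k hU γ (ofRatClassBaseChange (ComplexPoints (fiberOver f s.1)) k y) := by
  induction y using TensorProduct.induction_on with
  | zero => rw [map_zero, map_zero, map_zero, ← zero_smul ℂ (0 : complexBetti (fiberOver f s.1) k),
      transportFun_smul, zero_smul]
  | tmul c v =>
    rw [LinearMap.baseChange_tmul, ofRatClassBaseChange_tmul, ofRatClassBaseChange_tmul,
      transportFun_smul, LinearEquiv.coe_coe, hT]
  | add x y hx hy => rw [map_add, map_add, hx, hy, map_add, transportFun_add]

end FlatFrame

section Filtration

variable {n : ℕ} {X : SchemeOver ℂ}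

/-- **The Hodge filtration read in the flat (rational) frame**: for a smooth projective `X`, a Hodge
symmetric Hodge model `A` and `x ∈ Hᵏ(X(ℂ); ℂ)`, `x ∈ Fʳ` (`IsInHodgeFiltration`, any model) iff
`Θ⁻¹ x ∈ Fʳ` of the `ℚ`-Hodge structure `A.hodgeStructure` on `Hᵏ(X(ℂ); ℚ)` (`Θ = ofRatClassBaseChangeEquiv`;
independence of the model is the tree theorem `hodgePQ_independent_of_hodgeModel_holds`).
[cite: VoisinHodgeI2002, §7.1.1] -/
theorem isInHodgeFiltration_iff_symm_mem_hodgeStructure_F (hX : IsSmoothProjective n X)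
    (A : HodgeModel n X) (hA : A.IsHodgeSymmetric) (k r : ℕ) (x : complexBetti X k) :
    IsInHodgeFiltration n X k r x ↔
      (ofRatClassBaseChangeEquiv hX k).symm x ∈ (A.hodgeStructure hX hA k).F r := by
  rw [hodgePQ_independent_of_hodgeModel_holds.isInHodgeFiltration_iff hX A, HodgeModel.hodgeStructure_F,
    HodgeModel.mem_ratF_iff, HodgeModel.complexification_apply, ← ofRatClassBaseChangeEquiv_apply hX k,
    LinearEquiv.apply_symm_apply, Int.toNat_natCast]

/-- Membership in the span of the basis vectors of degree `≥ r` is the vanishing of the coordinates of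
degree `< r`. [folklore] -/
private theorem mem_span_image_deg_iff {N : ℕ} {V : Type*} [AddCommGroup V] [Module ℂ V]
    (e : Module.Basis (Fin N) ℂ V) (deg : Fin N → ℤ) (r : ℤ) (y : V) :
    y ∈ Submodule.span ℂ (e '' {σ | r ≤ deg σ}) ↔ ∀ σ, deg σ < r → e.repr y σ = 0 := by
  rw [Module.Basis.mem_span_image]
  constructor
  · intro h σ hσ
    by_contra hne
    exact not_le.mpr hσ (h (Finsupp.mem_support_iff.mpr hne))
  · intro h σ hσ
    by_contra hlt
    exact Finsupp.mem_support_iff.mp hσ (h σ (not_le.mp hlt))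

end Filtration


end HodgeTheory

end Literature.AlgebraicGeometry.HodgeTheory

/-! ### §2 The dichotomy on the Dwork pencil from Griffiths' theorem -/

namespace Literature.AlgebraicGeometry.HodgeTheory.DworkSextic

open CategoryTheory
open Literature.AlgebraicGeometry.Motives Literature.AlgebraicGeometry.Motives.UniversalHypersurface
open Literature.AlgebraicGeometry.HodgeTheory.UniversalHypersurface
open Literature.AlgebraicTopology.SingularHomology

/-- The base `D = 𝔸¹ ∖ μ₆` of the Dwork pencil is smooth of relative dimension `1` over `ℂ`.
[cite: Hartshorne1977, III §10 Example 10.0.1] -/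
theorem smoothOfRelativeDimension_one_pencilBase :
    AlgebraicGeometry.SmoothOfRelativeDimension 1 (baseSpz ℂ 4 6 pencilSpz).hom := by
  have h := smoothOfRelativeDimension_baseSpz_hom ℂ 4 6 pencilSpz
  have h1 : 0 + Nat.card Unit = 1 := by simp
  rwa [h1] at h

/-- **Voisin I Thm. 10.3 ⟹ the dichotomy of the locus `{s : ξ|_{𝒳_s} ∈ F²}` on the Dwork pencil**
(`Voisin2002_dworkPencil_hodgeFiltrationTwo_locus_dichotomy`, hitherto derived from the pencil-specific
named fact `Griffiths1968_dworkPencil_holomorphicHodgeFrames`), from the GENERAL named fact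
`Griffiths1968_holomorphicHodgeSubbundles`: over a small path-connected open `W ∋ t` inside a chart
`ψ : D(ℂ) → ℂ¹` take the graded holomorphic frame `e(s)` of `H⁴(X_t; ℚ) ⊗ ℂ` adapted to the transported
Hodge flags (`exists_holomorphicFrame_of_subbundleFrames`); the tube class `ξ` restricted to `X_s` is the
transport of `ξ|_{X_t}` (`transportFun_fiberRestrict`), i.e. the FIXED vector `y₀ = Θ⁻¹(ξ|_{X_t})` read
through the rational transport (`ofRatClassBaseChange_baseChange_eq_transportFun`), so `ξ|_{X_s} ∈ F²` iff
the coordinates of `y₀` of degree `< 2` in `e(s)` vanish — holomorphic functions of `ψ(s)`; accumulation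
at `t` forces them to vanish near `ψ(t)` (identity theorem in one variable), hence the locus is a
neighbourhood of `t`. [cite: VoisinHodgeI2002, §10.2.1 Thm. 10.3 and §9.2.1]
[cite: VoisinHodgeII2003, §5.3.1 Lemma 5.13] -/
theorem Voisin2002_dworkPencil_hodgeFiltrationTwo_locus_dichotomy_of_griffiths1968
    (hG : Griffiths1968_holomorphicHodgeSubbundles) :
    Voisin2002_dworkPencil_hodgeFiltrationTwo_locus_dichotomy := by
  classical
  intro B hBo ξ t htB hfreq
  -- the family data
  have hf : IsSmoothProjectiveFamily pencil 4 := isSmoothProjectiveFamily_pencil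
  have hS : IsQuasiProjectiveOver (baseSpz ℂ 4 6 pencilSpz) := isQuasiProjectiveOver_baseSpz 4 6 pencilSpz
  haveI := smoothOfRelativeDimension_one_pencilBase
  have hU : IsCohomologicallyLocallyTrivialOn pencil (Set.univ : Set (ComplexPoints (baseSpz ℂ 4 6 pencilSpz))) :=
    isCohomologicallyLocallyTrivialOn_univ_of_isSmoothProjectiveFamily pencil 1 hf hS
  let A : ∀ s : ComplexPoints (baseSpz ℂ 4 6 pencilSpz), HodgeModel 4 (fiberOver pencil s) := fun s ↦
    (exists_isReal_hodgeModel_holds 4 _ (hf.isSmoothProjective s)).choose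
  have hA : ∀ s, (A s).IsHodgeSymmetric := fun s ↦
    (exists_isReal_hodgeModel_holds 4 _ (hf.isSmoothProjective s)).choose_spec.isHodgeSymmetric
  haveI : ∀ s : ComplexPoints (baseSpz ℂ 4 6 pencilSpz),
      Module.Finite ℚ (singularCohomology ℚ ℚ (ComplexPoints (fiberOver pencil s)) (2 * 2)) := fun s ↦
    finite_singularCohomology_rat_complexPoints (hf.isSmoothProjective s) _
  haveI : HodgeTensorFacts.{0, 0} := Motives.hodgeTensorFacts_holds.{0, 0}
  -- topology of `D(ℂ)`: a manifold, hence locally path connected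
  haveI : AlgebraicGeometry.LocallyOfFiniteType (baseSpz ℂ 4 6 pencilSpz).hom := hS.locallyOfFiniteType
  haveI : AlgebraicGeometry.IsSeparated (baseSpz ℂ 4 6 pencilSpz).hom := hS.isVarietyPair_ofScheme.isSeparated
  haveI : T2Space (ComplexPoints (baseSpz ℂ 4 6 pencilSpz)) :=
    Literature.NumberTheory.Transcendental.t2Space_algPoints_holds _ ℂ
  letI := Motives.ComplexPoints.chartedSpace (baseSpz ℂ 4 6 pencilSpz) 1
  haveI : LocallyPathConnectedSpace (ComplexPoints (baseSpz ℂ 4 6 pencilSpz)) :=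
    ChartedSpace.locallyPathConnectedSpace (EuclideanSpace ℝ (Fin (2 * 1))) _
  haveI : LocallyPathConnectedSpace (Set.univ : Set (ComplexPoints (baseSpz ℂ 4 6 pencilSpz))) :=
    isOpen_univ.locallyPathConnectedSpace
  have hrat : ∀ (x y : (Set.univ : Set (ComplexPoints (baseSpz ℂ 4 6 pencilSpz))))
      (γ : Path.Homotopic.Quotient x y) (α : complexBetti (fiberOver pencil x.1) (2 * 2)), IsRationalClass α →
      IsRationalClass (transportFun pencil (2 * 2) hU γ α) :=
    fun x y γ α hα ↦ isRationalClass_transportFun_of_isSmoothProjectiveFamily pencil (2 * 2) 1 hf hS γ hα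
  -- the point `t` as a point of the subtype `univ`, and the neighbourhood `B`
  set t₁ : (Set.univ : Set (ComplexPoints (baseSpz ℂ 4 6 pencilSpz))) := ⟨t, Set.mem_univ t⟩ with ht₁
  set N : Set (Set.univ : Set (ComplexPoints (baseSpz ℂ 4 6 pencilSpz))) := {u | u.1 ∈ B} with hNdef
  have hN : N ∈ 𝓝 t₁ := (hBo.preimage continuous_subtype_val).mem_nhds (by exact htB)
  -- Griffiths' frames around `t`
  obtain ⟨W₀, hW₀o, ht₁W₀, hW₀N, hW₀pc, ψ, hW₀ψ, hfr⟩ := hG pencil 4 (2 * 2) 1 hf hS hU A hA t₁ t₁ N hN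
  set T₁ : singularCohomology ℚ ℚ (ComplexPoints (fiberOver pencil t₁.1)) (2 * 2) ≃ₗ[ℚ]
      singularCohomology ℚ ℚ (ComplexPoints (fiberOver pencil t₁.1)) (2 * 2) := LinearEquiv.refl ℚ _ with hT₁def
  have hT₁ : ∃ δ₁ : Path.Homotopic.Quotient t₁ t₁,
      ∀ v, ofRatClass _ (2 * 2) (T₁ v) = transportFun pencil (2 * 2) hU δ₁ (ofRatClass _ (2 * 2) v) :=
    ⟨Path.Homotopic.Quotient.refl t₁, fun v ↦ by rw [transportFun_refl]; rfl⟩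
  choose r w hw hwhol using hfr T₁ hT₁
  obtain ⟨W, hWo, ht₁W, hWW₀, hWpc, hW⟩ := exists_holomorphicFrame_of_subbundleFrames pencil (2 * 2) hU t₁ hrat
    (fun u ↦ (A u.1).hodgeStructure (hf.isSmoothProjective u.1) (hA u.1) (2 * 2)) hW₀o hW₀pc ψ hW₀ψ
    ht₁W₀ hT₁ r w hw hwhol
  obtain ⟨N', deg, e, hflag, -, hcoord⟩ := hW t₁ ht₁W T₁ hT₁
  have hWψ : W ⊆ ψ.source := hWW₀.trans hW₀ψ
  have hWB : ∀ u ∈ W, u.1 ∈ B := fun u hu ↦ hW₀N (hWW₀ hu)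
  -- the fixed vector `y₀ = Θ⁻¹(ξ|_{X_t})`
  set y₀ : ℂ ⊗[ℚ] singularCohomology ℚ ℚ (ComplexPoints (fiberOver pencil t₁.1)) (2 * 2) :=
    (ofRatClassBaseChangeEquiv (hf.isSmoothProjective t) (2 * 2)).symm (fiberRestrict pencil htB (2 * 2) ξ)
    with hy₀
  -- KEY: over `W`, `ξ|_{X_u} ∈ F²` iff the coordinates of `y₀` of degree `< 2` in `e(u)` vanish
  have hkey : ∀ (u : (Set.univ : Set (ComplexPoints (baseSpz ℂ 4 6 pencilSpz)))) (hu : u ∈ W),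
      IsInHodgeFiltration 4 (fiberOver pencil u.1) (2 * 2) 2 (fiberRestrict pencil (hWB u hu) (2 * 2) ξ) ↔
        ∀ σ, deg σ < 2 → (e u).repr y₀ σ = 0 := by
    intro u hu
    -- a path from `t` to `u` inside `W` and a rational transport along it
    obtain ⟨ε, hεW⟩ : ∃ ε : Path t₁ u, ∀ r', ε r' ∈ W :=
      ⟨(hWpc.joinedIn t₁ ht₁W u hu).somePath, (hWpc.joinedIn t₁ ht₁W u hu).somePath_mem⟩
    obtain ⟨T, hT⟩ := exists_ratTransport pencil (2 * 2) hU hrat (⟦ε⟧ : Path.Homotopic.Quotient t₁ u)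
    have hT' : ∀ v, ofRatClass _ (2 * 2) (T v) =
        transportFun pencil (2 * 2) hU ⟦ε⟧ (ofRatClass _ (2 * 2) (T₁ v)) := fun v ↦ hT v
    have hF := hflag u hu ε hεW T hT' 2
    -- the transported vector is `ξ|_{X_u}`
    have hflat : ofRatClassBaseChangeEquiv (hf.isSmoothProjective u.1) (2 * 2) (T.toLinearMap.baseChange ℂ y₀) =
        fiberRestrict pencil (hWB u hu) (2 * 2) ξ := by
      rw [ofRatClassBaseChangeEquiv_apply, ofRatClassBaseChange_baseChange_eq_transportFun pencil (2 * 2) hU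
        ⟦ε⟧ T hT y₀, hy₀, ← ofRatClassBaseChangeEquiv_apply (hf.isSmoothProjective t) (2 * 2),
        LinearEquiv.apply_symm_apply]
      exact transportFun_fiberRestrict pencil (2 * 2) hU hBo ε (fun r' ↦ hWB _ (hεW r')) htB (hWB u hu) ξ
    rw [isInHodgeFiltration_iff_symm_mem_hodgeStructure_F (hf.isSmoothProjective u.1) (A u.1) (hA u.1),
      ← mem_span_image_deg_iff (e u) deg 2 y₀, ← hF, Motives.HodgeStructure.comapEquiv_F, Submodule.mem_comap,
      ← hflat, LinearEquiv.symm_apply_apply]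
    norm_cast
  -- the chart read as a map to `ℂ` (charts of the curve `D(ℂ)` are valued in `ℂ¹ = Fin 1 → ℂ`)
  let Lz : ℂ →L[ℂ] (Fin 1 → ℂ) := ContinuousLinearMap.pi fun _ ↦ ContinuousLinearMap.id ℂ ℂ
  have hLz : ∀ q : Fin 1 → ℂ, Lz (q 0) = q := fun q ↦ funext fun i ↦ by
    rw [Fin.fin_one_eq_zero i]; rfl
  let Φ : ComplexPoints (baseSpz ℂ 4 6 pencilSpz) → ℂ := fun p ↦ ψ ⟨p, Set.mem_univ p⟩ 0
  have hΦψ : ∀ u : (Set.univ : Set (ComplexPoints (baseSpz ℂ 4 6 pencilSpz))), Lz (Φ u.1) = ψ u :=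
    fun u ↦ hLz (ψ u)
  -- the coordinate functions of `y₀`, as holomorphic functions on `Ω = Lz⁻¹(ψ(W)) ⊆ ℂ`
  let g : Fin N' → ℂ → ℂ := fun σ z ↦ (e (ψ.symm (Lz z))).repr y₀ σ
  have hΩo : IsOpen (Lz ⁻¹' (ψ '' W)) := (ψ.isOpen_image_of_subset_source hWo hWψ).preimage Lz.continuous
  have hg : ∀ σ, AnalyticOnNhd ℂ (g σ) (Lz ⁻¹' (ψ '' W)) := fun σ ↦
    (hcoord σ y₀).comp (Lz.analyticOnNhd _) (Set.mapsTo_preimage Lz (ψ '' W))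
  have hgΦ : ∀ u ∈ W, ∀ σ, g σ (Φ u.1) = (e u).repr y₀ σ := by
    intro u hu σ
    show (e (ψ.symm (Lz (Φ u.1)))).repr y₀ σ = (e u).repr y₀ σ
    rw [hΦψ u, ψ.left_inv (hWψ hu)]
  have hz₀ : Φ t ∈ Lz ⁻¹' (ψ '' W) := by
    show Lz (Φ t₁.1) ∈ ψ '' W
    rw [hΦψ t₁]
    exact ⟨t₁, ht₁W, rfl⟩
  obtain ⟨ρ, hρ, hball⟩ := Metric.isOpen_iff.mp hΩo (Φ t) hz₀
  -- `W` read in `D(ℂ)`, the continuity and local injectivity of `Φ` at `t`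
  set V : Set (ComplexPoints (baseSpz ℂ 4 6 pencilSpz)) :=
    {p | (⟨p, Set.mem_univ p⟩ : (Set.univ : Set (ComplexPoints (baseSpz ℂ 4 6 pencilSpz)))) ∈ W} with hVdef
  have hmk : Continuous fun p : ComplexPoints (baseSpz ℂ 4 6 pencilSpz) ↦
      (⟨p, Set.mem_univ p⟩ : (Set.univ : Set (ComplexPoints (baseSpz ℂ 4 6 pencilSpz)))) :=
    continuous_id.subtype_mk _
  have hVo : IsOpen V := hWo.preimage hmk
  have htV : t ∈ V := ht₁W
  have hΦc : ContinuousAt Φ t := by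
    have h1 : ContinuousAt (fun p : ComplexPoints (baseSpz ℂ 4 6 pencilSpz) ↦ ψ ⟨p, Set.mem_univ p⟩) t :=
      ContinuousAt.comp (f := fun p : ComplexPoints (baseSpz ℂ 4 6 pencilSpz) ↦
        (⟨p, Set.mem_univ p⟩ : (Set.univ : Set (ComplexPoints (baseSpz ℂ 4 6 pencilSpz))))) (g := ψ)
        (ψ.continuousAt (hWψ ht₁W)) hmk.continuousAt
    exact ContinuousAt.comp (f := fun p : ComplexPoints (baseSpz ℂ 4 6 pencilSpz) ↦ ψ ⟨p, Set.mem_univ p⟩)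
      (g := fun q : Fin 1 → ℂ ↦ q 0) (continuous_apply (0 : Fin 1)).continuousAt h1
  have hinj : ∀ p ∈ V, Φ p = Φ t → p = t := by
    intro p hpV h
    have h' : ψ ⟨p, Set.mem_univ p⟩ = ψ t₁ := by rw [← hΦψ ⟨p, Set.mem_univ p⟩, ← hΦψ t₁]; exact congrArg Lz h
    exact congrArg Subtype.val (ψ.injOn (hWψ hpV) (hWψ ht₁W) h')
  have hΦt : Tendsto Φ (𝓝[≠] t) (𝓝[≠] (Φ t)) := by
    refine tendsto_nhdsWithin_of_tendsto_nhds_of_eventually_within Φ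
      (hΦc.tendsto.mono_left nhdsWithin_le_nhds) ?_
    filter_upwards [self_mem_nhdsWithin, mem_nhdsWithin_of_mem_nhds (hVo.mem_nhds htV)] with p hp hpV
    exact fun h ↦ hp (hinj p hpV h)
  -- accumulation of the locus at `t` ⟹ the coordinates of degree `< 2` vanish frequently near `Φ t`
  have hfreq' : ∃ᶠ p in 𝓝[≠] t, ∀ σ, deg σ < 2 → g σ (Φ p) = 0 := by
    refine (hfreq.and_eventually (mem_nhdsWithin_of_mem_nhds (hVo.mem_nhds htV))).mono ?_
    rintro p ⟨⟨hpB, hpF⟩, hpV⟩ σ hσ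
    rw [hgΦ ⟨p, Set.mem_univ p⟩ hpV σ]
    exact (hkey ⟨p, Set.mem_univ p⟩ hpV).mp hpF σ hσ
  have hfreqC : ∃ᶠ z in 𝓝[≠] (Φ t), ∀ σ, deg σ < 2 → g σ z = 0 := hΦt.frequently hfreq'
  -- identity theorem on the disc: they vanish identically near `Φ t`
  have hvanish : ∀ σ, deg σ < 2 → Set.EqOn (g σ) 0 (Metric.ball (Φ t) ρ) := fun σ hσ ↦
    AnalyticOnNhd.eqOn_zero_of_preconnected_of_frequently_eq_zero ((hg σ).mono hball)
      (convex_ball (Φ t) ρ).isPreconnected (Metric.mem_ball_self hρ) (hfreqC.mono fun z hz ↦ hz σ hσ)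
  -- hence `ξ|_{X_p} ∈ F²` for every `p ∈ V` with `Φ p` in the disc: a neighbourhood of `t`
  have hnhds : {p | p ∈ V ∧ Φ p ∈ Metric.ball (Φ t) ρ} ∈ 𝓝 t :=
    Filter.inter_mem (hVo.mem_nhds htV)
      (hΦc.preimage_mem_nhds (Metric.isOpen_ball.mem_nhds (Metric.mem_ball_self hρ)))
  refine Filter.mem_of_superset hnhds ?_
  rintro p ⟨hpV, hpball⟩
  refine ⟨hWB _ hpV, (hkey ⟨p, Set.mem_univ p⟩ hpV).mpr fun σ hσ ↦ ?_⟩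
  rw [← hgΦ ⟨p, Set.mem_univ p⟩ hpV σ]
  exact hvanish σ hσ hpball

end Literature.AlgebraicGeometry.HodgeTheory.DworkSextic

end
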